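import Summits.Ventures.CertifiedManyBodySolver.Downfold.EmeryShapeWindowClosure
import HarnessLib

/-!
# THE WINDOW CLOSURE OVER A FILLING BAND: one pair of energy windows certified at the two END fillings bounds the fixed-doping `t′/t` of every member of a
# typed three-band box at EVERY filling in between (INFL-3to1-B §B.86 (k))

Venture CertifiedManyBodySolver, cell `pub/hubbard-downfold` (stage S1; INFLATION-RULES-3to1-B §B.86 (k)), seat hubbard-downfold-mod-4 (technique B = band level,
g35); namespace `Summit.Ventures.CertifiedManyBodySolver.Downfold.Emery`. Everything PROVED (0 sorry, no definition). WHAT THIS IS NOT: a statement about any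
material; `U = 0` one-body kinematics of the σ (d–p_x–p_y + t_pp, t_pp′) model (rigid band); no number lives here.

A typed box carries a hole-count ROW `n_H ∈ [n₁, n₂]`, i.e. a filling band `ν = (2 − n_H)/2 ∈ [ν₁, ν₂]`. `EmeryShapeWindowClosure` bounds object E at ONE filling.
Since the Fermi energy is non-decreasing in the filling (`EmeryFermiEnergyOf` §3), all four Fermi energies that enter the closure at filling `ν ∈ [ν₁, ν₂]` are bracketed
by their values at the END fillings: `ε_F(V_lo; ν) ≥ ε_F(V_lo; ν₁)`, `ε_F(A_lo; ν) ≤ ε_F(A_lo; ν₂)`, `ε_F(Δ₂, a₂, b₁, c₂; ν) ≥ ε_F(·; ν₁)`, `ε_F(V_hi; ν) ≤ ε_F(V_hi; ν₂)`, and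
the regime energy `ε_F(H; ν) ≤ ε_F(H; ν₂)`. Hence:

* `fermiEnergyOf_mono_filling'` — certificate-free monotonicity in the filling (`0 < ν ≤ ν′ < 1`).
* **`fsRatio_fermiEnergyOf_mem_Icc_windowClosure_band`** — for every member of `[Δ₁, Δ₂] × [a₁, a₂] × [b₁, b₂] × [c₁, c₂]` and EVERY `ν ∈ [ν₁, ν₂]`: `L ≤ R(θ; ν) ≤ U`
  whenever `L ≤ fsRatio(V_lo; ε)` on `[e₁, e₂] ⊇ [ε_F(V_lo; ν₁), ε_F(A_lo; ν₂)]` and `fsRatio(V_hi; ε) ≤ U` on `[e₃, e₄] ⊇ [ε_F(Δ₂, a₂, b₁, c₂; ν₁), ε_F(V_hi; ν₂)]`, with the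
  regime `c₂b₂·ε_F(H; ν₂) ≤ a₁²b₁` and the caps `(c₂b₂/b₁)e₂ ≤ a₁²`, `c₂e₄ ≤ a₂²` — the SAME four point brackets per end filling that the per-filling instances use,
  now read as ONE statement over the box's whole hole-count row (router/EMERY-SHAPE-CORNERS.tsv «band» rows; g19's EMERY-FS-WINDOWS semantics).

Sources: three-band model [HybertsenSchluterChristensen1989, Eq. (1)]; contour form [AndersenEtAl1995, §6]; arithmetic [folklore].
-/

noncomputable section

namespace Summit.Ventures.CertifiedManyBodySolver.Downfold.Emery

open Real Set

/-- The Fermi energy is non-decreasing in the filling, endpoint form, certificate-free (`Δ > 0`, `t_pd ≠ 0`, `0 < ν ≤ ν′ < 1`). [folklore] -/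
theorem fermiEnergyOf_mono_filling' {Δ a b c ν ν' : ℝ} (hΔ : 0 < Δ) (ha : a ≠ 0) (hc : 0 ≤ c) (hb : 0 ≤ b) (hν0 : 0 < ν) (hνν : ν ≤ ν') (hν1 : ν' < 1) :
    fermiEnergyOf Δ a b c ν ≤ fermiEnergyOf Δ a b c ν' := by
  obtain ⟨e1, -, he1⟩ := exists_fermiEnergy_of_mem_Ioo hΔ ha hc hb hν0 (lt_of_le_of_lt hνν hν1)
  obtain ⟨e2, -, he2⟩ := exists_fermiEnergy_of_mem_Ioo hΔ ha hc hb (lt_of_lt_of_le hν0 hνν) hν1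
  exact fermiEnergyOf_le_fermiEnergyOf hΔ.le hc hb hν0 hνν hν1 ⟨e1, he1⟩ ⟨e2, he2⟩

/-- **THE WINDOW CLOSURE OVER A FILLING BAND**: windows certified at the end fillings `ν₁ ≤ ν₂` bound the fixed-doping `t′/t` of every member at every
`ν ∈ [ν₁, ν₂]`. [folklore] -/
theorem fsRatio_fermiEnergyOf_mem_Icc_windowClosure_band {Δ a b c Δ₁ Δ₂ a₁ a₂ b₁ b₂ c₁ c₂ e₁ e₂ e₃ e₄ L U ν ν₁ ν₂ : ℝ} (hΔ₁ : 0 < Δ₁) (ha₁ : 0 < a₁)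
    (hb₁ : 0 < b₁) (hc₁ : 0 ≤ c₁) (hc₂b : c₂ ≤ b₁)
    (hΔ : Δ ∈ Icc Δ₁ Δ₂) (ha : a ∈ Icc a₁ a₂) (hb : b ∈ Icc b₁ b₂) (hc : c ∈ Icc c₁ c₂) (hν₁0 : 0 < ν₁) (hν : ν ∈ Icc ν₁ ν₂) (hν₂1 : ν₂ < 1)
    (hreg : c₂ * b₂ * fermiEnergyOf Δ₁ a₂ b₂ c₁ ν₂ ≤ a₁ ^ 2 * b₁)
    (he₁ : e₁ ≤ fermiEnergyOf Δ₁ a₁ b₂ (c₂ * b₂ / b₁) ν₁) (he₂ : fermiEnergyOf Δ₁ a₁ b₂ c₁ ν₂ ≤ e₂) (hcap₂ : c₂ * b₂ / b₁ * e₂ ≤ a₁ ^ 2)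
    (hL : ∀ ε ∈ Icc e₁ e₂, L ≤ fsRatio Δ₁ a₁ b₂ (c₂ * b₂ / b₁) ε)
    (he₃ : e₃ ≤ fermiEnergyOf Δ₂ a₂ b₁ c₂ ν₁) (he₄ : fermiEnergyOf Δ₂ a₂ b₁ (c₁ * b₁ / b₂) ν₂ ≤ e₄) (hcap₄ : c₂ * e₄ ≤ a₂ ^ 2)
    (hU : ∀ ε ∈ Icc e₃ e₄, fsRatio Δ₂ a₂ b₁ (c₁ * b₁ / b₂) ε ≤ U) :
    fsRatio Δ a b c (fermiEnergyOf Δ a b c ν) ∈ Icc L U := by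
  obtain ⟨hν1, hν2⟩ := hν
  have hν0 : 0 < ν := lt_of_lt_of_le hν₁0 hν1
  have hν1' : ν < 1 := lt_of_le_of_lt hν2 hν₂1
  have hΔ₂ : 0 < Δ₂ := lt_of_lt_of_le hΔ₁ (hΔ.1.trans hΔ.2)
  have ha₂ : 0 < a₂ := lt_of_lt_of_le ha₁ (ha.1.trans ha.2)
  have hb₂ : 0 < b₂ := lt_of_lt_of_le hb₁ (hb.1.trans hb.2)
  have hc₂ : 0 ≤ c₂ := hc₁.trans (hc.1.trans hc.2)
  have hcs0 : 0 ≤ c₂ * b₂ / b₁ := by positivity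
  have hcl0 : 0 ≤ c₁ * b₁ / b₂ := by positivity
  -- the five Fermi energies at ν are bracketed by their end-filling values
  have hH : fermiEnergyOf Δ₁ a₂ b₂ c₁ ν ≤ fermiEnergyOf Δ₁ a₂ b₂ c₁ ν₂ :=
    fermiEnergyOf_mono_filling' hΔ₁ ha₂.ne' hc₁ hb₂.le hν0 hν2 hν₂1
  have hVlo : fermiEnergyOf Δ₁ a₁ b₂ (c₂ * b₂ / b₁) ν₁ ≤ fermiEnergyOf Δ₁ a₁ b₂ (c₂ * b₂ / b₁) ν :=
    fermiEnergyOf_mono_filling' hΔ₁ ha₁.ne' hcs0 hb₂.le hν₁0 hν1 hν1'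
  have hAlo : fermiEnergyOf Δ₁ a₁ b₂ c₁ ν ≤ fermiEnergyOf Δ₁ a₁ b₂ c₁ ν₂ :=
    fermiEnergyOf_mono_filling' hΔ₁ ha₁.ne' hc₁ hb₂.le hν0 hν2 hν₂1
  have hLo2 : fermiEnergyOf Δ₂ a₂ b₁ c₂ ν₁ ≤ fermiEnergyOf Δ₂ a₂ b₁ c₂ ν :=
    fermiEnergyOf_mono_filling' hΔ₂ ha₂.ne' hc₂ hb₁.le hν₁0 hν1 hν1'
  have hVhi : fermiEnergyOf Δ₂ a₂ b₁ (c₁ * b₁ / b₂) ν ≤ fermiEnergyOf Δ₂ a₂ b₁ (c₁ * b₁ / b₂) ν₂ :=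
    fermiEnergyOf_mono_filling' hΔ₂ ha₂.ne' hcl0 hb₁.le hν0 hν2 hν₂1
  have hreg' : c₂ * b₂ * fermiEnergyOf Δ₁ a₂ b₂ c₁ ν ≤ a₁ ^ 2 * b₁ :=
    le_trans (mul_le_mul_of_nonneg_left hH (by positivity)) hreg
  exact fsRatio_fermiEnergyOf_mem_Icc_windowClosure hΔ₁ ha₁ hb₁ hc₁ hc₂b hΔ ha hb hc hν0 hν1' hreg' (he₁.trans hVlo) (hAlo.trans he₂) hcap₂ hL
    (he₃.trans hLo2) (hVhi.trans he₄) hcap₄ hU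

end Summit.Ventures.CertifiedManyBodySolver.Downfold.Emery
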